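import Summits.AtomisticToContinuum.HydrodynamicLimit.Theorems.CollisionIsometryCLTAdaptedWeightCLTBHEntropyBudgetDeriv

/-!
# Entropy budget (stub `stub_entropyBudget`, line `block-h-dissipation-closure`, crux `AdaptedWeightCLT`,
stmt-AtomisticToContinuum-14868; `--supports`) — helper 6: size of the transported entropy density

The derivative of the cell objects along a free flight (helper 5) is `cW⁻¹ ·` an expression `dF(v)` that is
LINEAR in the weight derivatives `β_i`. This file bounds the entropy-derivative integrand
`(1 + log f̂(v)) · dF(v)`:
* the MASTER POINTWISE BOUND
  `|(1 + log f̂) dF| ≤ (c₀ + |v−ū|²/(2h²)) · (B₁ (f̃ + M_{θ,ū} · (…)) + Σ_i |β_i| G_h(· − v_i))`,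
  `B₁ = Σ_i |β_i|`, `c₀ = 1 + Λ`, with only weight-free Gaussian-mixture profiles on the right;
  (its integrated form `≤ B₁ · Q(V,h,δ)` and an integrable dominator uniform in the weights follow in the next
  helpers; the factor `B₁ ≤ L V #{i : cw_i(x) ≠ 0}` of helper 4 is what makes the transport term `O((N+1)^{γc})`);
* empty cells (all data vanish) and the temperature window `h² ≤ θ̄ + h² ≤ h² + (2V)²/3`.
-/

namespace Summit.AtomisticToContinuum.HydrodynamicLimit.Theorems.BlockHDissipation

open scoped BigOperators Topology Classical MeasureTheory ENNReal InnerProductSpace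
open Filter Set MeasureTheory ProbabilityTheory
open Literature.Analysis.FluidPDE
open Literature.Analysis.FunctionSpaces (Torus.IsSmooth)
open Summit.AtomisticToContinuum.HydrodynamicLimit.Theorems.ContactSourceDuhamel (T3 V3 Cfg Vel Flow Flows)
open Literature.MathematicalPhysics.KineticTheory (localMaxwellian_pos localMaxwellian_nonneg continuous_localMaxwellian)

noncomputable section

namespace EntropyBudget

variable {N : ℕ} {ψ : ℕ → T3 → ℝ} {h δ : ℝ} (w : Cfg N) (x : T3)

/-! ## Sizes of the derivative data -/

/-- `|Σβ| ≤ B₁`. -/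
theorem abs_dS_le : |(∑ i, Literature.Analysis.FunctionSpaces.Torus.fderiv (ψ N) ((w i).1 - x) (w i).2)| ≤
    (∑ i, |Literature.Analysis.FunctionSpaces.Torus.fderiv (ψ N) ((w i).1 - x) (w i).2|) := Finset.abs_sum_le_sum_abs _ _

/-- `0 ≤ B₁`. -/
theorem B1_nonneg : 0 ≤ (∑ i, |Literature.Analysis.FunctionSpaces.Torus.fderiv (ψ N) ((w i).1 -
    x) (w i).2|) := Finset.sum_nonneg fun _ _ => abs_nonneg _

/-- `‖cW ∂_r ū‖ ≤ 2 V B₁`. -/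
theorem norm_dU_le (hψ : ∀ y, 0 ≤ ψ N y) {V : ℝ} (hV : ∀ i, ‖(w i).2‖ ≤ V) : ‖(-(∑ i, Literature.Analysis.FunctionSpaces.Torus.fderiv (ψ N) ((w i).1 -
    x) (w i).2) • cU N ψ w x + ∑ i, Literature.Analysis.FunctionSpaces.Torus.fderiv (ψ N) ((w i).1 - x) (w i).2 • (w i).2)‖ ≤ 2 * V *
    (∑ i, |Literature.Analysis.FunctionSpaces.Torus.fderiv (ψ N) ((w i).1 - x) (w i).2|) := by
  have hV0 := V_nonneg w hV
  calc ‖(-(∑ i, Literature.Analysis.FunctionSpaces.Torus.fderiv (ψ N) ((w i).1 - x) (w i).2) • cU N ψ w x +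
      ∑ i, Literature.Analysis.FunctionSpaces.Torus.fderiv (ψ N) ((w i).1 - x) (w i).2 • (w i).2)‖ ≤
      ‖-((∑ i, Literature.Analysis.FunctionSpaces.Torus.fderiv (ψ N) ((w i).1 - x) (w i).2)) • cU N ψ w x‖ +
        ‖∑ i, Literature.Analysis.FunctionSpaces.Torus.fderiv (ψ N) ((w i).1 - x) (w i).2 • (w i).2‖ := norm_add_le _ _
    _ ≤ (∑ i, |Literature.Analysis.FunctionSpaces.Torus.fderiv (ψ N) ((w i).1 - x) (w i).2|) * V +
        (∑ i, |Literature.Analysis.FunctionSpaces.Torus.fderiv (ψ N) ((w i).1 - x) (w i).2|) * V := by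
        refine add_le_add ?_ ?_
        · rw [norm_smul, Real.norm_eq_abs, abs_neg]
          exact mul_le_mul (abs_dS_le w x) (norm_cU_le w x hψ hV) (norm_nonneg _) (B1_nonneg w x)
        · calc ‖∑ i, Literature.Analysis.FunctionSpaces.Torus.fderiv (ψ N) ((w i).1 - x) (w i).2 • (w i).2‖
              ≤ ∑ i, ‖Literature.Analysis.FunctionSpaces.Torus.fderiv (ψ N) ((w i).1 - x) (w i).2 • (w i).2‖ :=
                norm_sum_le _ _
            _ ≤ ∑ i, |Literature.Analysis.FunctionSpaces.Torus.fderiv (ψ N) ((w i).1 - x) (w i).2| * V :=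
                Finset.sum_le_sum fun i _ => by
                  rw [norm_smul, Real.norm_eq_abs]
                  exact mul_le_mul_of_nonneg_left (hV i) (abs_nonneg _)
            _ = (∑ i, |Literature.Analysis.FunctionSpaces.Torus.fderiv (ψ N) ((w i).1 - x) (w i).2|) * V := by rw [Finset.sum_mul]
    _ = 2 * V * (∑ i, |Literature.Analysis.FunctionSpaces.Torus.fderiv (ψ N) ((w i).1 - x) (w i).2|) := by ring

/-- `|cW ∂_r θ̄| ≤ (8/3) V² B₁`. -/
theorem abs_dT_le (hψ : ∀ y, 0 ≤ ψ N y) {V : ℝ} (hV : ∀ i, ‖(w i).2‖ ≤ V) : |(-(∑ i, Literature.Analysis.FunctionSpaces.Torus.fderiv (ψ N) ((w i).1 -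
    x) (w i).2) * cT N ψ w x + ∑ i, Literature.Analysis.FunctionSpaces.Torus.fderiv (ψ N) ((w i).1 - x) (w i).2 * (‖(w i).2 - cU N ψ w x‖ ^ 2 / 3))| ≤
    8 / 3 * V ^ 2 * (∑ i, |Literature.Analysis.FunctionSpaces.Torus.fderiv (ψ N) ((w i).1 - x) (w i).2|) := by
  have hT := cT_le w x hψ hV
  have hT0 := cT_nonneg (ψ := ψ) w x hψ
  calc |(-(∑ i, Literature.Analysis.FunctionSpaces.Torus.fderiv (ψ N) ((w i).1 - x) (w i).2) * cT N ψ w x +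
      ∑ i, Literature.Analysis.FunctionSpaces.Torus.fderiv (ψ N) ((w i).1 - x) (w i).2 * (‖(w i).2 - cU N ψ w x‖ ^ 2 / 3))| ≤
      |-((∑ i, Literature.Analysis.FunctionSpaces.Torus.fderiv (ψ N) ((w i).1 - x) (w i).2)) * cT N ψ w x| +
        |∑ i, Literature.Analysis.FunctionSpaces.Torus.fderiv (ψ N) ((w i).1 - x) (w i).2 * (‖(w i).2 - cU N ψ w x‖ ^ 2 / 3)| :=
        abs_add_le _ _
    _ ≤ (∑ i, |Literature.Analysis.FunctionSpaces.Torus.fderiv (ψ N) ((w i).1 - x) (w i).2|) * ((2 * V) ^ 2 / 3) +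
        (∑ i, |Literature.Analysis.FunctionSpaces.Torus.fderiv (ψ N) ((w i).1 - x) (w i).2|) * ((2 * V) ^ 2 / 3) := by
        refine add_le_add ?_ ?_
        · rw [abs_mul, abs_neg, abs_of_nonneg hT0]
          exact mul_le_mul (abs_dS_le w x) hT hT0 (B1_nonneg w x)
        · calc |∑ i, Literature.Analysis.FunctionSpaces.Torus.fderiv (ψ N) ((w i).1 - x) (w i).2 *
                (‖(w i).2 - cU N ψ w x‖ ^ 2 / 3)|
              ≤ ∑ i, |Literature.Analysis.FunctionSpaces.Torus.fderiv (ψ N) ((w i).1 - x) (w i).2 *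
                (‖(w i).2 - cU N ψ w x‖ ^ 2 / 3)| := Finset.abs_sum_le_sum_abs _ _
            _ ≤ ∑ i, |Literature.Analysis.FunctionSpaces.Torus.fderiv (ψ N) ((w i).1 - x) (w i).2| * ((2 * V) ^ 2 / 3) :=
                Finset.sum_le_sum fun i _ => by
                  rw [abs_mul, abs_of_nonneg (show 0 ≤ ‖(w i).2 - cU N ψ w x‖ ^ 2 / 3 by positivity)]
                  exact mul_le_mul_of_nonneg_left (div_le_div_of_nonneg_right
                    (pow_le_pow_left₀ (norm_nonneg _) (norm_vel_sub_cU_le w x hψ hV i) 2) (by norm_num)) (abs_nonneg _)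
            _ = (∑ i, |Literature.Analysis.FunctionSpaces.Torus.fderiv (ψ N) ((w i).1 - x) (w i).2|) * ((2 * V) ^ 2 / 3) := by rw [Finset.sum_mul]
    _ = 8 / 3 * V ^ 2 * (∑ i, |Literature.Analysis.FunctionSpaces.Torus.fderiv (ψ N) ((w i).1 - x) (w i).2|) := by ring

/-- `|cW ∂_r f̃(v)| ≤ B₁ f̃(v) + Σ_i |β_i| G_h(v − v_i)`. -/
theorem abs_dK_le (hψ : ∀ y, 0 ≤ ψ N y) (hh : 0 < h) (v : V3) :
    |(-(∑ i, Literature.Analysis.FunctionSpaces.Torus.fderiv (ψ N) ((w i).1 - x) (w i).2) * kde N ψ h w x (v) +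
        ∑ i, Literature.Analysis.FunctionSpaces.Torus.fderiv (ψ N) ((w i).1 - x) (w i).2 * gauss h (w i).2 (v))| ≤
        (∑ i, |Literature.Analysis.FunctionSpaces.Torus.fderiv (ψ N) ((w i).1 - x) (w i).2|) * kde N ψ h w x v +
      ∑ i, |Literature.Analysis.FunctionSpaces.Torus.fderiv (ψ N) ((w i).1 - x) (w i).2| * gauss h (w i).2 v := by
  have hk := kde_nonneg w x hψ hh v
  calc |(-(∑ i, Literature.Analysis.FunctionSpaces.Torus.fderiv (ψ N) ((w i).1 - x) (w i).2) * kde N ψ h w x (v) +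
      ∑ i, Literature.Analysis.FunctionSpaces.Torus.fderiv (ψ N) ((w i).1 - x) (w i).2 * gauss h (w i).2 (v))| ≤
      |-((∑ i, Literature.Analysis.FunctionSpaces.Torus.fderiv (ψ N) ((w i).1 - x) (w i).2)) * kde N ψ h w x v| +
        |∑ i, Literature.Analysis.FunctionSpaces.Torus.fderiv (ψ N) ((w i).1 - x) (w i).2 * gauss h (w i).2 v| :=
        abs_add_le _ _
    _ ≤ _ := by
        refine add_le_add ?_ ?_
        · rw [abs_mul, abs_neg, abs_of_nonneg hk]
          exact mul_le_mul_of_nonneg_right (abs_dS_le w x) hk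
        · refine (Finset.abs_sum_le_sum_abs _ _).trans (Finset.sum_le_sum fun i _ => ?_)
          rw [abs_mul, abs_of_nonneg (gauss_pos hh _ _).le]

/-- `|cW ∂_r M(v)| ≤ B₁ · M_{θ,ū}(v) · ((8/3) V² (|v−ū|²/(2h⁴) + 3/(2h²)) + 2V |v−ū|/h²)`. -/
theorem abs_dM_le (hψ : ∀ y, 0 ≤ ψ N y) (hh : 0 < h) {V : ℝ} (hV : ∀ i, ‖(w i).2‖ ≤ V) (v : V3) :
    |(localMaxwellian 1 (cT N ψ w x + h ^ 2) (cU N ψ w x) (v) * ((-(∑ i, Literature.Analysis.FunctionSpaces.Torus.fderiv (ψ N) ((w i).1 -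
        x) (w i).2) * cT N ψ w x + ∑ i, Literature.Analysis.FunctionSpaces.Torus.fderiv (ψ N) ((w i).1 - x) (w i).2 * (‖(w i).2 -
        cU N ψ w x‖ ^ 2 / 3)) * (‖(v) - cU N ψ w x‖ ^ 2 / (2 * (cT N ψ w x + h ^ 2) ^ 2) - 3 / (2 * (cT N ψ w x + h ^ 2))) + inner ℝ ((v) -
        cU N ψ w x) (-(∑ i, Literature.Analysis.FunctionSpaces.Torus.fderiv (ψ N) ((w i).1 - x) (w i).2) • cU N ψ w x +
        ∑ i, Literature.Analysis.FunctionSpaces.Torus.fderiv (ψ N) ((w i).1 - x) (w i).2 • (w i).2) / (cT N ψ w x + h ^ 2)))| ≤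
        (∑ i, |Literature.Analysis.FunctionSpaces.Torus.fderiv (ψ N) ((w i).1 - x) (w i).2|) * (localMaxwellian 1 (cT N ψ w x +
        h ^ 2) (cU N ψ w x) v *
      (8 / 3 * V ^ 2 * (‖v - cU N ψ w x‖ ^ 2 / (2 * h ^ 4) + 3 / (2 * h ^ 2)) + 2 * V * ‖v - cU N ψ w x‖ / h ^ 2)) := by
  have h1 := abs_dlM_le (θ' := (-(∑ i, Literature.Analysis.FunctionSpaces.Torus.fderiv (ψ N) ((w i).1 - x) (w i).2) * cT N ψ w x +
      ∑ i, Literature.Analysis.FunctionSpaces.Torus.fderiv (ψ N) ((w i).1 - x) (w i).2 * (‖(w i).2 -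
      cU N ψ w x‖ ^ 2 / 3))) (u' := (-(∑ i, Literature.Analysis.FunctionSpaces.Torus.fderiv (ψ N) ((w i).1 - x) (w i).2) • cU N ψ w x +
      ∑ i, Literature.Analysis.FunctionSpaces.Torus.fderiv (ψ N) ((w i).1 - x) (w i).2 • (w i).2)) (u := cU N ψ w x) hh (h2_le_theta w x hψ) v
  have hM := localMaxwellian_nonneg zero_le_one (theta_pos (h := h) w x hψ hh).le (cU N ψ w x) v
  have hdT := abs_dT_le w x hψ hV
  have hdU := norm_dU_le w x hψ hV
  have hq : 0 ≤ ‖v - cU N ψ w x‖ ^ 2 / (2 * h ^ 4) + 3 / (2 * h ^ 2) := by positivity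
  have hn : 0 ≤ ‖v - cU N ψ w x‖ := norm_nonneg _
  refine h1.trans ?_
  have h2 : |(-(∑ i, Literature.Analysis.FunctionSpaces.Torus.fderiv (ψ N) ((w i).1 - x) (w i).2) * cT N ψ w x +
      ∑ i, Literature.Analysis.FunctionSpaces.Torus.fderiv (ψ N) ((w i).1 - x) (w i).2 * (‖(w i).2 - cU N ψ w x‖ ^ 2 / 3))| * (‖v -
      cU N ψ w x‖ ^ 2 / (2 * h ^ 4) + 3 / (2 * h ^ 2)) + ‖v - cU N ψ w x‖ * ‖(-(∑ i, Literature.Analysis.FunctionSpaces.Torus.fderiv (ψ N) ((w i).1 -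
      x) (w i).2) • cU N ψ w x + ∑ i, Literature.Analysis.FunctionSpaces.Torus.fderiv (ψ N) ((w i).1 - x) (w i).2 • (w i).2)‖ / h ^ 2 ≤
      (∑ i, |Literature.Analysis.FunctionSpaces.Torus.fderiv (ψ N) ((w i).1 - x) (w i).2|) * (8 / 3 * V ^ 2 * (‖v - cU N ψ w x‖ ^ 2 / (2 * h ^ 4) +
          3 / (2 * h ^ 2)) +
        2 * V * ‖v - cU N ψ w x‖ / h ^ 2) := by
    have e : (∑ i, |Literature.Analysis.FunctionSpaces.Torus.fderiv (ψ N) ((w i).1 - x) (w i).2|) * (8 / 3 * V ^ 2 * (‖v - cU N ψ w x‖ ^ 2 / (2 *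
        h ^ 4) + 3 / (2 * h ^ 2)) +
        2 * V * ‖v - cU N ψ w x‖ / h ^ 2) = (8 / 3 * V ^ 2 * (∑ i, |Literature.Analysis.FunctionSpaces.Torus.fderiv (ψ N) ((w i).1 -
            x) (w i).2|)) * (‖v - cU N ψ w x‖ ^ 2 / (2 * h ^ 4) +
          3 / (2 * h ^ 2)) + ‖v - cU N ψ w x‖ * (2 * V * (∑ i, |Literature.Analysis.FunctionSpaces.Torus.fderiv (ψ N) ((w i).1 -
              x) (w i).2|)) / h ^ 2 := by ring
    rw [e]
    refine add_le_add (mul_le_mul_of_nonneg_right hdT hq) (div_le_div_of_nonneg_right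
      (mul_le_mul_of_nonneg_left hdU hn) (by positivity))
  calc localMaxwellian 1 (cT N ψ w x + h ^ 2) (cU N ψ w x) v *
        (|(-(∑ i, Literature.Analysis.FunctionSpaces.Torus.fderiv (ψ N) ((w i).1 - x) (w i).2) * cT N ψ w x +
            ∑ i, Literature.Analysis.FunctionSpaces.Torus.fderiv (ψ N) ((w i).1 - x) (w i).2 * (‖(w i).2 - cU N ψ w x‖ ^ 2 / 3))| * (‖v -
            cU N ψ w x‖ ^ 2 / (2 * h ^ 4) + 3 / (2 * h ^ 2)) + ‖v - cU N ψ w x‖ *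
            ‖(-(∑ i, Literature.Analysis.FunctionSpaces.Torus.fderiv (ψ N) ((w i).1 - x) (w i).2) • cU N ψ w x +
            ∑ i, Literature.Analysis.FunctionSpaces.Torus.fderiv (ψ N) ((w i).1 - x) (w i).2 • (w i).2)‖ / h ^ 2)
      ≤ localMaxwellian 1 (cT N ψ w x + h ^ 2) (cU N ψ w x) v * ((∑ i, |Literature.Analysis.FunctionSpaces.Torus.fderiv (ψ N) ((w i).1 -
          x) (w i).2|) * (8 / 3 * V ^ 2 *
          (‖v - cU N ψ w x‖ ^ 2 / (2 * h ^ 4) + 3 / (2 * h ^ 2)) + 2 * V * ‖v - cU N ψ w x‖ / h ^ 2)) :=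
        mul_le_mul_of_nonneg_left h2 hM
    _ = _ := by ring

/-! ## The master pointwise bound -/

/-- **MASTER POINTWISE BOUND.** With `B₁ = Σ|β_i|`, `q = |v − ū|²`, `θ = θ̄ + h²`,
`c₀ = 1 + |log (2πh²)^{-3/2}| + |log δ| + (3/2)|log 2πθ|`:
`|(1 + log f̂(v)) dF(v)| ≤ (c₀ + q/(2h²)) (B₁ (f̃(v) + M_{θ,ū}(v)((8/3)V²(q/(2h⁴) + 3/(2h²)) + 2V√q/h²))
 + Σ_i |β_i| G_h(v − v_i))`. -/
theorem abs_integrand_le (hψ : ∀ y, 0 ≤ ψ N y) (hh : 0 < h) (hδ : 0 < δ) (hδ1 : δ ≤ 1) {V : ℝ}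
    (hV : ∀ i, ‖(w i).2‖ ≤ V) (v : V3) :
    |(1 + Real.log (cellLaw N ψ h δ w x v)) * ((1 - δ) * (-(∑ i, Literature.Analysis.FunctionSpaces.Torus.fderiv (ψ N) ((w i).1 - x) (w i).2) *
        kde N ψ h w x (v) + ∑ i, Literature.Analysis.FunctionSpaces.Torus.fderiv (ψ N) ((w i).1 - x) (w i).2 * gauss h (w i).2 (v)) + δ *
        (localMaxwellian 1 (cT N ψ w x + h ^ 2) (cU N ψ w x) (v) * ((-(∑ i, Literature.Analysis.FunctionSpaces.Torus.fderiv (ψ N) ((w i).1 -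
        x) (w i).2) * cT N ψ w x + ∑ i, Literature.Analysis.FunctionSpaces.Torus.fderiv (ψ N) ((w i).1 - x) (w i).2 * (‖(w i).2 -
        cU N ψ w x‖ ^ 2 / 3)) * (‖(v) - cU N ψ w x‖ ^ 2 / (2 * (cT N ψ w x + h ^ 2) ^ 2) - 3 / (2 * (cT N ψ w x + h ^ 2))) + inner ℝ ((v) -
        cU N ψ w x) (-(∑ i, Literature.Analysis.FunctionSpaces.Torus.fderiv (ψ N) ((w i).1 - x) (w i).2) • cU N ψ w x +
        ∑ i, Literature.Analysis.FunctionSpaces.Torus.fderiv (ψ N) ((w i).1 - x) (w i).2 • (w i).2) / (cT N ψ w x + h ^ 2))))| ≤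
      ((1 + |Real.log ((2 * Real.pi * h ^ 2) ^ (-(3 : ℝ) / 2))| + |Real.log δ| +
          3 / 2 * |Real.log (2 * Real.pi * (cT N ψ w x + h ^ 2))|) + ‖v - cU N ψ w x‖ ^ 2 / (2 * h ^ 2)) *
        ((∑ i, |Literature.Analysis.FunctionSpaces.Torus.fderiv (ψ N) ((w i).1 - x) (w i).2|) * (kde N ψ h w x v + localMaxwellian 1 (cT N ψ w x +
            h ^ 2) (cU N ψ w x) v *
            (8 / 3 * V ^ 2 * (‖v - cU N ψ w x‖ ^ 2 / (2 * h ^ 4) + 3 / (2 * h ^ 2)) + 2 * V * ‖v - cU N ψ w x‖ / h ^ 2)) +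
          ∑ i, |Literature.Analysis.FunctionSpaces.Torus.fderiv (ψ N) ((w i).1 - x) (w i).2| * gauss h (w i).2 v) := by
  have hlog := abs_log_cellLaw_le (δ := δ) w x hψ hh hδ hδ1 v
  have hK := abs_dK_le (h := h) w x hψ hh v
  have hM := abs_dM_le w x hψ hh hV v
  have hB := B1_nonneg (ψ := ψ) w x
  have hδ0 : 0 ≤ 1 - δ := by linarith
  rw [abs_mul]
  refine mul_le_mul ?_ ?_ (abs_nonneg _) (by positivity)
  · calc |1 + Real.log (cellLaw N ψ h δ w x v)| ≤ |(1 : ℝ)| + |Real.log (cellLaw N ψ h δ w x v)| := abs_add_le _ _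
      _ ≤ _ := by rw [abs_one]; linarith
  · calc |((1 - δ) * (-(∑ i, Literature.Analysis.FunctionSpaces.Torus.fderiv (ψ N) ((w i).1 - x) (w i).2) * kde N ψ h w x (v) +
      ∑ i, Literature.Analysis.FunctionSpaces.Torus.fderiv (ψ N) ((w i).1 - x) (w i).2 * gauss h (w i).2 (v)) + δ * (localMaxwellian 1 (cT N ψ w x +
      h ^ 2) (cU N ψ w x) (v) * ((-(∑ i, Literature.Analysis.FunctionSpaces.Torus.fderiv (ψ N) ((w i).1 - x) (w i).2) * cT N ψ w x +
      ∑ i, Literature.Analysis.FunctionSpaces.Torus.fderiv (ψ N) ((w i).1 - x) (w i).2 * (‖(w i).2 - cU N ψ w x‖ ^ 2 / 3)) * (‖(v) -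
      cU N ψ w x‖ ^ 2 / (2 * (cT N ψ w x + h ^ 2) ^ 2) - 3 / (2 * (cT N ψ w x + h ^ 2))) + inner ℝ ((v) -
      cU N ψ w x) (-(∑ i, Literature.Analysis.FunctionSpaces.Torus.fderiv (ψ N) ((w i).1 - x) (w i).2) • cU N ψ w x +
      ∑ i, Literature.Analysis.FunctionSpaces.Torus.fderiv (ψ N) ((w i).1 - x) (w i).2 • (w i).2) / (cT N ψ w x + h ^ 2))))| ≤ |(1 - δ) *
      (-(∑ i, Literature.Analysis.FunctionSpaces.Torus.fderiv (ψ N) ((w i).1 - x) (w i).2) * kde N ψ h w x (v) +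
      ∑ i, Literature.Analysis.FunctionSpaces.Torus.fderiv (ψ N) ((w i).1 - x) (w i).2 * gauss h (w i).2 (v))| + |δ * (localMaxwellian 1 (cT N ψ w x +
      h ^ 2) (cU N ψ w x) (v) * ((-(∑ i, Literature.Analysis.FunctionSpaces.Torus.fderiv (ψ N) ((w i).1 - x) (w i).2) * cT N ψ w x +
      ∑ i, Literature.Analysis.FunctionSpaces.Torus.fderiv (ψ N) ((w i).1 - x) (w i).2 * (‖(w i).2 - cU N ψ w x‖ ^ 2 / 3)) * (‖(v) -
      cU N ψ w x‖ ^ 2 / (2 * (cT N ψ w x + h ^ 2) ^ 2) - 3 / (2 * (cT N ψ w x + h ^ 2))) + inner ℝ ((v) -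
      cU N ψ w x) (-(∑ i, Literature.Analysis.FunctionSpaces.Torus.fderiv (ψ N) ((w i).1 - x) (w i).2) • cU N ψ w x +
      ∑ i, Literature.Analysis.FunctionSpaces.Torus.fderiv (ψ N) ((w i).1 - x) (w i).2 • (w i).2) / (cT N ψ w x + h ^ 2)))| := abs_add_le _ _
      _ = (1 - δ) * |(-(∑ i, Literature.Analysis.FunctionSpaces.Torus.fderiv (ψ N) ((w i).1 - x) (w i).2) * kde N ψ h w x (v) +
          ∑ i, Literature.Analysis.FunctionSpaces.Torus.fderiv (ψ N) ((w i).1 - x) (w i).2 * gauss h (w i).2 (v))| + δ *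
          |(localMaxwellian 1 (cT N ψ w x + h ^ 2) (cU N ψ w x) (v) * ((-(∑ i, Literature.Analysis.FunctionSpaces.Torus.fderiv (ψ N) ((w i).1 -
          x) (w i).2) * cT N ψ w x + ∑ i, Literature.Analysis.FunctionSpaces.Torus.fderiv (ψ N) ((w i).1 - x) (w i).2 * (‖(w i).2 -
          cU N ψ w x‖ ^ 2 / 3)) * (‖(v) - cU N ψ w x‖ ^ 2 / (2 * (cT N ψ w x + h ^ 2) ^ 2) - 3 / (2 * (cT N ψ w x + h ^ 2))) + inner ℝ ((v) -
          cU N ψ w x) (-(∑ i, Literature.Analysis.FunctionSpaces.Torus.fderiv (ψ N) ((w i).1 - x) (w i).2) • cU N ψ w x +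
          ∑ i, Literature.Analysis.FunctionSpaces.Torus.fderiv (ψ N) ((w i).1 - x) (w i).2 • (w i).2) / (cT N ψ w x + h ^ 2)))| := by
          rw [abs_mul, abs_mul, abs_of_nonneg hδ0, abs_of_nonneg hδ.le]
      _ ≤ 1 * |(-(∑ i, Literature.Analysis.FunctionSpaces.Torus.fderiv (ψ N) ((w i).1 - x) (w i).2) * kde N ψ h w x (v) +
          ∑ i, Literature.Analysis.FunctionSpaces.Torus.fderiv (ψ N) ((w i).1 - x) (w i).2 * gauss h (w i).2 (v))| + 1 *
          |(localMaxwellian 1 (cT N ψ w x + h ^ 2) (cU N ψ w x) (v) * ((-(∑ i, Literature.Analysis.FunctionSpaces.Torus.fderiv (ψ N) ((w i).1 -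
          x) (w i).2) * cT N ψ w x + ∑ i, Literature.Analysis.FunctionSpaces.Torus.fderiv (ψ N) ((w i).1 - x) (w i).2 * (‖(w i).2 -
          cU N ψ w x‖ ^ 2 / 3)) * (‖(v) - cU N ψ w x‖ ^ 2 / (2 * (cT N ψ w x + h ^ 2) ^ 2) - 3 / (2 * (cT N ψ w x + h ^ 2))) + inner ℝ ((v) -
          cU N ψ w x) (-(∑ i, Literature.Analysis.FunctionSpaces.Torus.fderiv (ψ N) ((w i).1 - x) (w i).2) • cU N ψ w x +
          ∑ i, Literature.Analysis.FunctionSpaces.Torus.fderiv (ψ N) ((w i).1 - x) (w i).2 • (w i).2) / (cT N ψ w x + h ^ 2)))| :=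
          add_le_add (mul_le_mul_of_nonneg_right (by linarith) (abs_nonneg _))
            (mul_le_mul_of_nonneg_right hδ1 (abs_nonneg _))
      _ ≤ _ := by rw [one_mul, one_mul]; linarith


/-! ## Empty cells: all derivative data vanish -/

/-- In an empty cell `dF ≡ 0` (every `β_i` vanishes with `cw_i`). -/
theorem dF_eq_zero_of_cW (hψ : ∀ y, 0 ≤ ψ N y) (hS : cW N ψ w x = 0) (v : V3) : ((1 - δ) *
    (-(∑ i, Literature.Analysis.FunctionSpaces.Torus.fderiv (ψ N) ((w i).1 - x) (w i).2) * kde N ψ h w x (v) +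
    ∑ i, Literature.Analysis.FunctionSpaces.Torus.fderiv (ψ N) ((w i).1 - x) (w i).2 * gauss h (w i).2 (v)) + δ * (localMaxwellian 1 (cT N ψ w x +
    h ^ 2) (cU N ψ w x) (v) * ((-(∑ i, Literature.Analysis.FunctionSpaces.Torus.fderiv (ψ N) ((w i).1 - x) (w i).2) * cT N ψ w x +
    ∑ i, Literature.Analysis.FunctionSpaces.Torus.fderiv (ψ N) ((w i).1 - x) (w i).2 * (‖(w i).2 - cU N ψ w x‖ ^ 2 / 3)) * (‖(v) -
    cU N ψ w x‖ ^ 2 / (2 * (cT N ψ w x + h ^ 2) ^ 2) - 3 / (2 * (cT N ψ w x + h ^ 2))) + inner ℝ ((v) -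
    cU N ψ w x) (-(∑ i, Literature.Analysis.FunctionSpaces.Torus.fderiv (ψ N) ((w i).1 - x) (w i).2) • cU N ψ w x +
    ∑ i, Literature.Analysis.FunctionSpaces.Torus.fderiv (ψ N) ((w i).1 - x) (w i).2 • (w i).2) / (cT N ψ w x + h ^ 2)))) = 0 := by
  have hz : ∀ i, Literature.Analysis.FunctionSpaces.Torus.fderiv (ψ N) ((w i).1 - x) (w i).2 = 0 :=
    fun i => dcw_eq_zero_of w x hψ (cw_eq_zero_of_cW w x hψ hS i)
  simp only [hz, Finset.sum_const_zero, neg_zero, zero_smul, zero_mul, add_zero, inner_zero_right, zero_div,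
    mul_zero]

/-- In an empty cell `B₁ = 0`. -/
theorem B1_eq_zero_of_cW (hψ : ∀ y, 0 ≤ ψ N y) (hS : cW N ψ w x = 0) : (∑ i, |Literature.Analysis.FunctionSpaces.Torus.fderiv (ψ N) ((w i).1 -
    x) (w i).2|) = 0 :=
  Finset.sum_eq_zero fun i _ => by rw [dcw_eq_zero_of w x hψ (cw_eq_zero_of_cW w x hψ hS i), abs_zero]

/-! ## Uniformity in the temperature -/

/-- For `h² ≤ θ ≤ Θ`: `|log 2πθ| ≤ |log 2πh²| + |log 2πΘ|` (the logarithm is monotone). -/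
theorem abs_log_between {θ Θ : ℝ} (hh : 0 < h) (hθ : h ^ 2 ≤ θ) (hΘ : θ ≤ Θ) :
    |Real.log (2 * Real.pi * θ)| ≤ |Real.log (2 * Real.pi * h ^ 2)| + |Real.log (2 * Real.pi * Θ)| := by
  have h1 : Real.log (2 * Real.pi * h ^ 2) ≤ Real.log (2 * Real.pi * θ) :=
    Real.log_le_log (by positivity) (by nlinarith [Real.pi_pos])
  have hθ0 : 0 < θ := lt_of_lt_of_le (by positivity) hθ
  have h2 : Real.log (2 * Real.pi * θ) ≤ Real.log (2 * Real.pi * Θ) :=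
    Real.log_le_log (by positivity) (by nlinarith [Real.pi_pos])
  have h3 := neg_abs_le (Real.log (2 * Real.pi * h ^ 2))
  have h4 := le_abs_self (Real.log (2 * Real.pi * Θ))
  rw [abs_le]
  constructor <;> linarith [abs_nonneg (Real.log (2 * Real.pi * h ^ 2)), abs_nonneg (Real.log (2 * Real.pi * Θ))]

/-- The cell temperature window: `h² ≤ θ̄ + h² ≤ Θ := h² + (2V)²/3`. -/
theorem theta_le (hψ : ∀ y, 0 ≤ ψ N y) {V : ℝ} (hV : ∀ i, ‖(w i).2‖ ≤ V) :
    cT N ψ w x + h ^ 2 ≤ h ^ 2 + (2 * V) ^ 2 / 3 := by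
  linarith [cT_le w x hψ hV]

/-- `(1 + |v|)⁴ ≤ 8 + 8 |v − 0|⁴`, the polynomial weight in the form of helper 1's domination helper. -/
theorem one_add_norm_pow_four_le (v : V3) : ‖(1 + ‖v‖) ^ 4‖ ≤ 8 + 8 * ‖v - 0‖ ^ 4 := by
  rw [sub_zero, Real.norm_eq_abs, abs_of_nonneg (by positivity)]
  have h := add_pow_le zero_le_one (norm_nonneg v) 4
  norm_num at h
  linarith

end EntropyBudget

/-- Registered anchor of this helper file (`--supports stmt-AtomisticToContinuum-14868`, helper of
`stub_entropyBudget`): the temperature-window bound for the logarithm used to make the entropy-density estimates uniform in the cell temperature. -/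
theorem bhEntropyBudget_derivBound_anchor : ∀ (h θ Θ : ℝ), 0 < h → h ^ 2 ≤ θ → θ ≤ Θ → |Real.log (2 * Real.pi * θ)| ≤ |Real.log (2 * Real.pi *
    h ^ 2)| + |Real.log (2 * Real.pi * Θ)| :=
  fun _ _ _ hh hθ hΘ => EntropyBudget.abs_log_between hh hθ hΘ

end

end Summit.AtomisticToContinuum.HydrodynamicLimit.Theorems.BlockHDissipation
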